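import Literature.Probability.RandomMatrix.UnitaryInvariantPolar
import Literature.Probability.Distributions.BetaGammaRatioTV
import HarnessLib

/-!
# Truncations of uniform points on complex spheres versus Gaussian vectors

Let `h ∼ γ^{n+p}` be a standard complex Gaussian vector indexed by `Fin n ⊕ Fin p`, so that
`u = h/‖h‖` is uniformly distributed on the unit sphere of `ℂ^{n+p}`. The map

  `sphereTrunc n p m h = √m · (h_{inl i})_{i<n} / ‖h‖`

returns the first `n` coordinates of the point `√m · u` of the sphere of radius `√m`. The main
result `tvClose_sphereTrunc` is the complex-coordinates Diaconis–Freedman bound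

  `‖Law(sphereTrunc n p m h) − γ^n‖_TV ≤ 8 n²/m`   for `1 ≤ n`, `1 ≤ p ≤ m ≤ 2n + p`

(the regime `n + p ≈ m` of truncations of Haar unitaries). Proof: both laws are invariant under
`U(n)` (`map_sphereTrunc_map_unitary`, unitary invariance of `γ`), so by the polar factorisation
(`tvClose_of_unitaryInvariant`) it suffices to compare the laws of `‖x‖²`: these are
`m S₁/(S₁+S₂)` with `(S₁,S₂) ∼ Gamma(n,1) ⊗ Gamma(p,1)` (`gaussianPi_sum_map_normSq_pair`) and
`Gamma(n,1)` (`gaussianPi_map_sum_normSq`), which are `8n²/m`-close (`tvClose_betaGammaRatio`).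

## References

* P. Diaconis, D. Freedman, *A dozen de Finetti-style results in search of a theory*,
  Ann. Inst. H. Poincaré Probab. Statist. 23 (1987) 397–423, Thm. 1 (real case,
  `‖P_k − 𝒩(0,I_k)‖ ≤ 2(k+3)/(n−k−3)` for the first `k` coordinates of a uniform point on
  `√n S^{n−1}`).
-/

open MeasureTheory ProbabilityTheory WithLp Matrix
open scoped ENNReal NNReal

namespace Literature.Probability.RandomMatrix

open Literature.MeasureTheory.TotalVariation
open Literature.Probability.Distributions (tvClose_betaGammaRatio)
open Literature.Computability.QuantumComplexity (stdComplexGaussian)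

variable {n p : ℕ}

/-- The first `n` coordinates of `√m · h/‖h‖`: for `h ∈ ℂ^{n+p}` (indexed by `Fin n ⊕ Fin p`),
`sphereTrunc n p m h = (√m/‖h‖) · (h_{inl i})_{i<n}` (with the convention `·/0 = 0`). For
`h ∼ γ^{n+p}` this is the `n`-truncation of a uniform point on the sphere of radius `√m` in
`ℂ^{n+p}`. [folklore] -/
noncomputable def sphereTrunc (n p : ℕ) (m : ℝ) (h : Fin n ⊕ Fin p → ℂ) : Fin n → ℂ :=
  fun i => ((Real.sqrt m / Real.sqrt (∑ k, ‖h k‖ ^ 2) : ℝ) : ℂ) * h (Sum.inl i)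

/-- `sphereTrunc` is measurable. [folklore] -/
theorem measurable_sphereTrunc (n p : ℕ) (m : ℝ) : Measurable (sphereTrunc n p m) := by
  unfold sphereTrunc
  refine measurable_pi_lambda _ fun i => ?_
  refine Measurable.mul ?_ (measurable_pi_apply _)
  exact Complex.measurable_ofReal.comp (measurable_const.div (by fun_prop))

/-- The block action of `U ∈ U(n)` on `ℂ^{n+p}`: `U` on the `inl`-coordinates, identity on the
`inr`-coordinates. [folklore] -/
def blockAct (U : Matrix.unitaryGroup (Fin n) ℂ) (h : Fin n ⊕ Fin p → ℂ) : Fin n ⊕ Fin p → ℂ :=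
  fun k => Sum.elim ((U : Matrix (Fin n) (Fin n) ℂ) *ᵥ fun i => h (Sum.inl i)) (fun j => h (Sum.inr j)) k

/-- The block action is measurable. [folklore] -/
theorem measurable_blockAct (U : Matrix.unitaryGroup (Fin n) ℂ) : Measurable (blockAct (p := p) U) := by
  refine measurable_pi_lambda _ fun k => ?_
  rcases k with i | j
  · simp only [blockAct, Sum.elim_inl]
    have h1 : Measurable fun h : Fin n ⊕ Fin p → ℂ => fun i => h (Sum.inl i) :=
      measurable_pi_lambda _ fun i => measurable_pi_apply _
    have h2 : Measurable fun x : Fin n → ℂ => (U : Matrix (Fin n) (Fin n) ℂ) *ᵥ x :=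
      (Matrix.mulVecLin (U : Matrix (Fin n) (Fin n) ℂ)).continuous_of_finiteDimensional.measurable
    exact (measurable_pi_apply i).comp (h2.comp h1)
  · simp only [blockAct, Sum.elim_inr]
    exact measurable_pi_apply _

/-- The block action preserves `γ^{n+p}`. [folklore] -/
theorem gaussianPi_map_blockAct (U : Matrix.unitaryGroup (Fin n) ℂ) :
    (gaussianPi (Fin n ⊕ Fin p)).map (blockAct U) = gaussianPi (Fin n ⊕ Fin p) := by
  have hmp := measurePreserving_sumPiEquivProdPi (fun _ : Fin n ⊕ Fin p => stdComplexGaussian)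
  set e := MeasurableEquiv.sumPiEquivProdPi (fun _ : Fin n ⊕ Fin p => ℂ) with he
  have hU : Measurable fun x : Fin n → ℂ => (U : Matrix (Fin n) (Fin n) ℂ) *ᵥ x :=
    (Matrix.mulVecLin (U : Matrix (Fin n) (Fin n) ℂ)).continuous_of_finiteDimensional.measurable
  have hfact : blockAct (p := p) U =
      e.symm ∘ Prod.map (fun x : Fin n → ℂ => (U : Matrix (Fin n) (Fin n) ℂ) *ᵥ x) id ∘ e := by
    funext h; funext k
    rcases k with i | j <;> rfl
  have hpi : gaussianPi (Fin n ⊕ Fin p) = ((gaussianPi (Fin n)).prod (gaussianPi (Fin p))).map e.symm := by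
    rw [gaussianPi, gaussianPi, gaussianPi, ← hmp.symm.map_eq]
  have hP : Measurable (Prod.map (fun x : Fin n → ℂ => (U : Matrix (Fin n) (Fin n) ℂ) *ᵥ x)
      (id : (Fin p → ℂ) → Fin p → ℂ)) := hU.prodMap measurable_id
  rw [hfact, ← Measure.map_map e.symm.measurable (hP.comp e.measurable),
    ← Measure.map_map hP e.measurable]
  rw [show gaussianPi (Fin n ⊕ Fin p) = Measure.pi (fun _ : Fin n ⊕ Fin p => stdComplexGaussian)
    from rfl, hmp.map_eq, ← Measure.map_prod_map _ _ hU measurable_id, Measure.map_id]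
  change (((gaussianPi (Fin n)).map (fun x => (U : Matrix (Fin n) (Fin n) ℂ) *ᵥ x)).prod
    (gaussianPi (Fin p))).map e.symm = _
  rw [gaussianPi_map_unitary_mulVec U, ← hpi]
  rfl

/-- The squared norm is invariant under the block action. [folklore] -/
theorem sum_normSq_blockAct (U : Matrix.unitaryGroup (Fin n) ℂ) (h : Fin n ⊕ Fin p → ℂ) :
    ∑ k, ‖blockAct U h k‖ ^ 2 = ∑ k, ‖h k‖ ^ 2 := by
  rw [Fintype.sum_sum_type, Fintype.sum_sum_type]
  simp only [blockAct, Sum.elim_inl, Sum.elim_inr]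
  congr 1
  exact vecNormSq_unitary_mulVec U fun i => h (Sum.inl i)

/-- Equivariance: `sphereTrunc (blockAct U h) = U · sphereTrunc h`. [folklore] -/
theorem sphereTrunc_blockAct (U : Matrix.unitaryGroup (Fin n) ℂ) (m : ℝ) (h : Fin n ⊕ Fin p → ℂ) :
    sphereTrunc n p m (blockAct U h) = (U : Matrix (Fin n) (Fin n) ℂ) *ᵥ sphereTrunc n p m h := by
  have hsph : ∀ g : Fin n ⊕ Fin p → ℂ, sphereTrunc n p m g =
      ((Real.sqrt m / Real.sqrt (∑ k, ‖g k‖ ^ 2) : ℝ) : ℂ) • fun i => g (Sum.inl i) := by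
    intro g; funext i; rfl
  rw [hsph, hsph, sum_normSq_blockAct, mulVec_smul]
  rfl

/-- **`U(n)`-invariance of the truncated sphere law.** [folklore] -/
theorem map_sphereTrunc_map_unitary (m : ℝ) (U : Matrix.unitaryGroup (Fin n) ℂ) :
    ((gaussianPi (Fin n ⊕ Fin p)).map (sphereTrunc n p m)).map
        (fun x => (U : Matrix (Fin n) (Fin n) ℂ) *ᵥ x) =
      (gaussianPi (Fin n ⊕ Fin p)).map (sphereTrunc n p m) := by
  have hU : Measurable fun x : Fin n → ℂ => (U : Matrix (Fin n) (Fin n) ℂ) *ᵥ x :=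
    (Matrix.mulVecLin (U : Matrix (Fin n) (Fin n) ℂ)).continuous_of_finiteDimensional.measurable
  rw [Measure.map_map hU (measurable_sphereTrunc n p m)]
  have : (fun x => (U : Matrix (Fin n) (Fin n) ℂ) *ᵥ x) ∘ sphereTrunc n p m =
      sphereTrunc n p m ∘ blockAct U := by
    funext h; exact (sphereTrunc_blockAct U m h).symm
  rw [this, ← Measure.map_map (measurable_sphereTrunc n p m) (measurable_blockAct U),
    gaussianPi_map_blockAct]

/-- The squared norm of the truncation: `‖sphereTrunc h‖² = m S₁/(S₁+S₂)` with
`S₁ = ∑_{inl} |h|²`, `S₂ = ∑_{inr} |h|²` (also when `S₁ + S₂ = 0`, by `·/0 = 0`). [folklore] -/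
theorem vecNormSq_sphereTrunc {m : ℝ} (hm : 0 ≤ m) (h : Fin n ⊕ Fin p → ℂ) :
    vecNormSq (sphereTrunc n p m h) =
      m * (∑ i, ‖h (Sum.inl i)‖ ^ 2) / ((∑ i, ‖h (Sum.inl i)‖ ^ 2) + ∑ j, ‖h (Sum.inr j)‖ ^ 2) := by
  have hS : ∑ k, ‖h k‖ ^ 2 = (∑ i, ‖h (Sum.inl i)‖ ^ 2) + ∑ j, ‖h (Sum.inr j)‖ ^ 2 :=
    Fintype.sum_sum_type _
  have hS0 : 0 ≤ ∑ k, ‖h k‖ ^ 2 := Finset.sum_nonneg fun k _ => by positivity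
  unfold vecNormSq sphereTrunc
  have : ∀ i : Fin n, ‖(((Real.sqrt m / Real.sqrt (∑ k, ‖h k‖ ^ 2) : ℝ) : ℂ)) * h (Sum.inl i)‖ ^ 2 =
      (m / ∑ k, ‖h k‖ ^ 2) * ‖h (Sum.inl i)‖ ^ 2 := by
    intro i
    rw [norm_mul, mul_pow, Complex.norm_real, Real.norm_eq_abs, sq_abs, div_pow,
      Real.sq_sqrt hm, Real.sq_sqrt hS0]
  simp_rw [this]
  rw [← Finset.mul_sum, ← hS, div_mul_eq_mul_div]

/-- **Diaconis–Freedman bound, complex coordinates.** For `1 ≤ n`, `1 ≤ p ≤ m ≤ 2n + p`, the law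
of the first `n` coordinates of `√m` times a uniformly random point of the unit sphere of
`ℂ^{n+p}` is within `8n²/m` of the standard complex Gaussian vector `γ^n` in total variation
(setwise). [cite: DiaconisFreedman1987, Thm. 1 (complex-coordinates variant; constant adapted to the regime `n + p ≈ m`)] -/
theorem tvClose_sphereTrunc {m : ℕ} (hn : 1 ≤ n) (hp : 1 ≤ p) (hpm : p ≤ m)
    (hm : m ≤ 2 * n + p) :
    TVClose ((gaussianPi (Fin n ⊕ Fin p)).map (sphereTrunc n p m)) (gaussianPi (Fin n))
      (8 * (n:ℝ) ^ 2 / m) := by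
  haveI : IsProbabilityMeasure ((gaussianPi (Fin n ⊕ Fin p)).map (sphereTrunc n p m)) :=
    Measure.isProbabilityMeasure_map (measurable_sphereTrunc n p m).aemeasurable
  refine tvClose_of_unitaryInvariant _ _ (map_sphereTrunc_map_unitary (m:ℝ))
    gaussianPi_map_unitary_mulVec ?_
  -- radial laws
  have hS : Measurable fun x : Fin n ⊕ Fin p → ℂ =>
      ((∑ i, ‖x (Sum.inl i)‖ ^ 2 : ℝ), (∑ j, ‖x (Sum.inr j)‖ ^ 2 : ℝ)) := by fun_prop
  have hr : Measurable fun q : ℝ × ℝ => (m:ℝ) * q.1 / (q.1 + q.2) := by fun_prop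
  have h1 : ((gaussianPi (Fin n ⊕ Fin p)).map (sphereTrunc n p m)).map vecNormSq =
      ((gammaMeasure n 1).prod (gammaMeasure p 1)).map
        (fun q : ℝ × ℝ => (m:ℝ) * q.1 / (q.1 + q.2)) := by
    rw [Measure.map_map measurable_vecNormSq (measurable_sphereTrunc n p m),
      ← gaussianPi_sum_map_normSq_pair hn hp, Measure.map_map hr hS]
    congr 1
    funext h
    exact vecNormSq_sphereTrunc (Nat.cast_nonneg m) h
  have h2 : (gaussianPi (Fin n)).map vecNormSq = gammaMeasure n 1 :=
    gaussianPi_map_sum_normSq hn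
  rw [h1, h2]
  exact tvClose_betaGammaRatio hn hp hpm hm

end Literature.Probability.RandomMatrix
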